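import Literature.Probability.Percolation.MeanClusterSizeTwoPoint
import Literature.Probability.Percolation.OneArmQuasiMultNearCritical
import Mathlib.Analysis.SpecialFunctions.Pow.Real
import HarnessLib

/-!
# Lower bound `χ^f(p) ≥ c L_ε(p)² π₁(L_ε(p))²` from one-arm stability and RSW circuits below `L_ε`

Topic `Literature/Probability/Percolation`; family `crit-perc`, statement **crit-perc.S16**, named fact
`Literature.Probability.Percolation.triMeanClusterSize_exponent` (`χ^f(p) = |p - 1/2|^{-43/18 + o(1)}`;
Smirnov–Werner 2001, §2, Thm. 1 (ii); Nolin 2008, §7.5). Proofs only (no definition, no named fact).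
Fourth brick of the bottom-up reduction of that fact to the tree's near-critical named facts (after
`MeanClusterSizeScaling.lean`, `MeanClusterSizeTwoPoint.lean`, `MeanClusterSizeExponentAssembly.lean`,
`MeanClusterSizeUpperBound.lean`): the LOWER half of Nolin's
`χ(p) = E_p[|C(0)|; |C(0)| < ∞] ≍ L(p)² π₁²(L(p))` (*Electron. J. Probab.* **13** (2008), §7.5,
Lemma 42 and Prop. 43 of arXiv 0711.4948; Kesten 1987), in the printed form
`χ^f(p) ≥ c L_ε(p)² π₁(L_ε(p))²`.

## Statement (`triMeanClusterSize_ge_sq_at`, `triMeanClusterSize_ge_sq`)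

From the near-critical stability of ONE arm below `L_ε(p)` (the body of `Nolin2008_thm27_oneArm`
at `ε`; only the lower half `P_p(0 ↔ ∂Λ_N) ≥ c₁ π₁(N)`, `N ≤ L_ε(p)`, is used), for every
`ε ∈ (0, 1/2)` there are `δ > 0`, `L₀`, `c > 0` with `χ^f(p) ≥ c L_ε(p)² π₁(L_ε(p))²` (in `ℝ≥0∞`)
for all `p ≠ 1/2` with `|p - 1/2| < δ` and `L_ε(p) ≥ L₀`; and the logarithmic consequence
`χ^f(p) ≥ c L_ε(p)^{43/24 - η}` under the one-arm exponent
(`triMeanClusterSize_powerLowerBound_of_sq_at`), the shape consumed by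
`MeanClusterSizeExponentAssembly.triMeanClusterSize_exponent_of_powerBounds`. Everything else —
RSW below `L_ε` for the sub-critical colour, circuits, confinement, gluing — is PROVED here from the
tree.

## Proof (Nolin 2008, §7.5, Lemma 42 lower bound and Lemma 41 item 2 lower bound, at `t = 0`)

Printed: "`Σ_x P_p(0 ↔ x, |C(0)| < ∞) ≥ P_p(∃ white circuit in S_{L,2L}) Σ_{x ∈ S_L} P_p(0 ↔^{S_L} x)
≥ δ₄⁴ Σ …`" and "if `0` is connected to `∂S_n` and if there exists a black circuit in `S_{2n/3,n}`,
then any `x ∈ S_{n/3,2n/3}` connected to `∂S_{2n}(x)` will be connected to `0` in `S_n`. Using the FKG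
inequality … `P(0 ↔^{S_n} x) ≥ δ₆⁴ P(0 ↔ ∂S_n) P(x ↔ ∂S_{2n}(x)) ≥ C₁ π₁²(n)`". Here, with
`L = L_ε(p) ≥ 400`, `k = 4⌊L/64⌋ + 2` (`k ≡ 2 (mod 4)`, `14k ≤ L ≤ 8(4k+1)`), `k' = 2k + 2`:

* *RSW below `L_ε` for both colours* (`exists_le_triLRCrossingProb_seven_below_charLength`): for
  `q ≥ min(p, 1-p)` and `6 ≤ m < L_ε(p)`, `m ≡ 2 (mod 4)`: `P_q(LR(7m, m)) ≥ c₇`, from the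
  definition of `L_ε` (`lt_triLRCrossingProb_of_lt_charLength`), Bollobás–Riordan's two-scale RSW at
  every density (`TriHexagon.triLRCrossingProb_two_scale`, scales `2j` and `m = 4j+2`) and chaining
  (`pow_mul_pow_le_triLRCrossingProb_of_le`); hence six long crossings of the pieces of the hexagonal
  annulus `5m ≤ |·|_𝕋 ≤ 7m` with probability `≥ c₇⁶` (Harris, the tree's `pow_six_le_real_iInter_isoTBCrossing_at`),
  which contain a circuit separating `‖·‖ ≤ 4m` from `‖·‖ ≥ 8m` (`mem_triOpenCircuit_of_pieces`,
  from the tree's `exists_circuit_of_crossings`, `mem_triOpenCircuit_of_circuit`).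
* *Per site* `x ∈ S_{2k}` (so `|x|_𝕋 ≤ 4k`): `P_p(0 ↔ x, |C(0)| < ∞) ≥ P_p(E_x) · P_p(W)` where
  `E_x = {0 ↔ x in Λ_{10k}}` and `W = {closed circuit through the six pieces at scale k'}` have
  disjoint supports (`Λ_{10k}` versus `5k' = 10k + 10 ≤ |·|_𝕋 ≤ 7k'`; `sitePercolation_real_inter_of_disjoint`)
  and `E_x ∩ W ⊆ {0 ↔ x, |C(0)| < ∞}` (a closed circuit around the origin confines its open cluster,
  `siteCluster_finite_of_compl_mem_triOpenCircuit`). By complementation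
  (`sitePercolation_real_preimage_compl`) `P_p(W) = P_{1-p}(six open crossings) ≥ c₇⁶`.
* `E_x ⊇ {0 ↔ ∂Λ_{10k}} ∩ {open circuit in (4k, 8k)} ∩ {x ↔ x + ∂Λ_{14k}}`
  (`mem_siteConnIn_of_arms_of_circuit`: both arms reach norm `8k`, meet the circuit
  (`triOpenCircuit_glue`), and the relevant pieces stay inside `Λ_{10k}`); by Harris (twice,
  `sitePercolation_harris'`), translation invariance and one-arm stability at the scales
  `10k, 14k ≤ L` (and `π₁(10k), π₁(14k) ≥ π₁(L)`): `P_p(E_x) ≥ c₁ π₁(L) · c₇⁶ · c₁ π₁(L)`.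
* Summing over the `(4k+1)² ≥ L²/64` sites of `S_{2k}` (`ENNReal.sum_le_tsum`,
  `triMeanClusterSize_eq_tsum`): `χ^f(p) ≥ (c₁² c₇¹²/64) L² π₁(L)²`.

No case distinction between `p < 1/2` and `p > 1/2` is needed: the RSW input holds for every
density `q ≥ min(p, 1-p)`, and the one-arm stability is two-sided.

## References

* P. Nolin, Near-critical percolation in two dimensions, *Electron. J. Probab.* 13 (2008)
  1562–1623, §7.5, Lemma 41 (item 2), Lemma 42, Prop. 43 (arXiv 0711.4948 numbering; EJP numbers
  are shifted by two); §3.1 Thm. 2 (RSW); §2.2 (white circuits) [Nolin2008].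
* B. Bollobás, O. Riordan, *Percolation*, CUP (2006), Ch. 3 Lemma 4 / Cor. 5; Ch. 7 §7.2.1 proof of
  Lemma 4 [BollobasRiordan2006].
* S. Smirnov, W. Werner, Critical exponents for two-dimensional percolation, *Math. Res. Lett.* 8
  (2001), §2, Thm. 1 (ii) [SmirnovWernerMRL2001].
* H. Kesten, Scaling relations for 2D-percolation, *Comm. Math. Phys.* 109 (1987) [KestenScalingCMP1987].

## Mathlib / tree

Mathlib: `Real.rpow`, `ENNReal.sum_le_tsum`, `Equiv.subRight`, `SimpleGraph.Walk`. Tree: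
`triMeanClusterSize_eq_tsum`, `triConn_eq_iUnion`, `determinedBy_preimage_relabel_triOneArm`
(`MeanClusterSizeTwoPoint.lean`); `isoTBCrossing`, `pieceIso`, `piece_subset_box`,
`triNorm_mem_Icc_of_mem_piece`, `exists_circuit_of_crossings`, `mem_triOpenCircuit_of_circuit`,
`triSitePercolation_real_isoTBCrossing` (`TriAnnulusCircuit.lean`); `triOpenCircuit`,
`triOpenCircuit_glue`, `determinedBy_triOpenCircuit`, `sitePercolation_real_inter_iInter_ge`,
`norm_triEmbed_le_triNorm`, `mul_triNorm_le_norm_triEmbed`, `subset_box_of_norm_le` (`OneArmLSW.lean`);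
`TriHexagon.triLRCrossingProb_two_scale` (`TriRSWTwoScale.lean`); `pow_six_le_real_iInter_isoTBCrossing_at`
(`OneArmQuasiMultNearCritical.lean`); `pow_mul_pow_le_triLRCrossingProb_of_le`,
`pathIn_shift`, `PathIn.of_mem_siteCluster` (`TriRSWChaining.lean`); `sitePercolation_real_preimage_compl`
(`TriHexLemma.lean`); `TriHexExclusive.triLRCrossingProb_mono`; `lt_triLRCrossingProb_of_lt_charLength`,
`charLength`, `critOneArmProb` (`KestenScaling.lean`); `Nolin2008_thm27_oneArm`, `determinedBy_triOneArm`,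
`isUpperSet_triOneArm` (`NearCriticalScaling.lean`); `triOneArm_anti` (`NearCriticalCorrelationLength.lean`);
`sitePercolation_harris'`, `sitePercolation_real_inter_of_disjoint`, `sitePercolation_real_preimage_relabel`;
`isUpperSet_preimage_relabel` (`TriShiftedCrossings.lean`).
-/

noncomputable section

open MeasureTheory Set Filter Topology
open scoped ENNReal unitInterval

namespace Literature.Probability.Percolation

open LatticeModels

/-! ### RSW below the characteristic length, for the sub-critical colour -/

/-- **Long crossings below `L_ε`, aspect ratio `7`**: for `ε ∈ (0, 1/2)` there is `c₇ > 0` such that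
for every `p`, every parameter `q ≥ min(p, 1 - p)` (in particular `q = p` and `q = 1 - p`) and every
scale `k ≡ 2 (mod 4)`, `6 ≤ k < L_ε(p)`: `P_q(LR_𝕋(7k, k)) ≥ c₇`. The rhombus crossing
probabilities at the scales `2j` and `k = 4j + 2 < L_ε(p)` exceed `ε` at `min(p, 1-p)` (definition of
`L_ε`) hence at `q` (monotonicity); Bollobás–Riordan's two-scale RSW (`triLRCrossingProb_two_scale`)
gives the aspect-`2` crossing at height `k`, and chaining (`pow_mul_pow_le_triLRCrossingProb_of_le`)
the aspect-`7` one. (Nolin 2008, §3.1, Thm. 2 / §7.1: "RSW considerations on scales `n ≤ L(p)`";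
here unconditionally, as in `exists_pow_le_triLRCrossingProb_holds`.) [cite: Nolin2008, §3.1 Thm. "Russo–Seymour–Welsh" (arXiv 0711.4948: Thm. 2) and §7.1] [cite: BollobasRiordan2006, Ch. 3 Lemma 4, Cor. 5] -/
theorem exists_le_triLRCrossingProb_seven_below_charLength {ε : ℝ} (hε : 0 < ε) :
    ∃ c > (0 : ℝ), ∀ (p q : unitInterval), min p (σ p) ≤ q → ∀ k : ℕ, 6 ≤ k → k % 4 = 2 →
      k < charLength ε p → c ≤ triLRCrossingProb q (7 * k) k := by
  refine ⟨((ε / 2) ^ 396) ^ 6 * ε ^ 5, by positivity, ?_⟩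
  intro p q hq k hk6 hk4 hkL
  have hscale : ∀ m : ℕ, m ≤ k → ε ≤ triLRCrossingProb q m m := fun m hm =>
    (lt_triLRCrossingProb_of_lt_charLength (lt_of_le_of_lt hm hkL)).le.trans
      (TriHexExclusive.triLRCrossingProb_mono hq m m)
  obtain ⟨j, hj⟩ : ∃ j, k = 4 * j + 2 := ⟨k / 4, by omega⟩
  have hj1 : 1 ≤ j := by omega
  have h2 : (ε / 2) ^ 396 ≤ triLRCrossingProb q (2 * k) k := by
    have := TriHexagon.triLRCrossingProb_two_scale q hj1 hε.le (hscale (2 * j) (by omega))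
      (hscale (4 * j + 2) (by omega))
    rw [hj]
    convert this using 2
    ring
  have hchain := pow_mul_pow_le_triLRCrossingProb_of_le q k (by positivity) hε.le h2
    (hscale k le_rfl) (j := 6) (by norm_num) (w := 7 * k) (by omega)
  simpa using hchain

/-! ### Six crossed pieces: probability at every density, and the circuit they contain -/

-- `pow_six_le_real_iInter_isoTBCrossing_at` (Harris for the six crossings at density `p`) is the
-- tree's (`OneArmQuasiMultNearCritical.lean`).

/-- **Six crossed pieces give a separating circuit** in the Euclidean annulus `(4k, 8k)`
(`exists_circuit_of_crossings`, `mem_triOpenCircuit_of_circuit` with `R = 4k`: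
`4k < (√3/2)·5k`, `7k < 8k`). [cite: BollobasRiordan2006, Ch. 7 §7.2.1, proof of Lemma 4] -/
theorem mem_triOpenCircuit_of_pieces {k : ℕ} (hk : 1 ≤ k) {ω : SiteConfig (Site 2)}
    (hω : ω ∈ ⋂ j < 6, isoTBCrossing (pieceIso k j) k (7 * k)) :
    ω ∈ triOpenCircuit (4 * k) (2 * (4 * k)) := by
  simp only [Set.mem_iInter] at hω
  obtain ⟨v, w, hw, h1⟩ := exists_circuit_of_crossings hk hω
  have hsqrt : (17 / 10 : ℝ) < Real.sqrt 3 := by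
    rw [Real.lt_sqrt (by norm_num)]; norm_num
  have hk1 : (1 : ℝ) ≤ k := by exact_mod_cast hk
  refine mem_triOpenCircuit_of_circuit (R := 4 * k) ?_ ?_ w hw h1
  · nlinarith
  · linarith

/-- The six-piece event at scale `k` is determined by the sites `z` with `5k ≤ |z|_𝕋 ≤ 7k`
(`triNorm_mem_Icc_of_mem_piece`), a subset of the rhombus `S_{7k}`. [folklore] -/
theorem determinedBy_iInter_isoTBCrossing (k : ℕ) :
    DeterminedBy (⋂ j < 6, isoTBCrossing (pieceIso k j) k (7 * k))
      ↑((box 2 (7 * k)).filter fun z => (5 * k : ℤ) ≤ triNorm z) := by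
  refine DeterminedBy.iInter fun j => DeterminedBy.iInter fun hj =>
    (determinedBy_isoTBCrossing _ _ _).mono fun z hz => ?_
  rw [Finset.coe_filter, Set.mem_setOf_eq]
  exact ⟨piece_subset_box hj hz, (triNorm_mem_Icc_of_mem_piece hj hz).1⟩

/-! ### Complementation: closed circuits -/

/-- If `A` is determined by the sites of `S`, so is `{ω | ωᶜ ∈ A}`. [folklore] -/
theorem determinedBy_compl_preimage {V : Type*} {A : Set (SiteConfig V)} {S : Set V}
    (hA : DeterminedBy A S) : DeterminedBy ((compl : SiteConfig V → SiteConfig V) ⁻¹' A) S := by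
  rw [determinedBy_iff] at hA ⊢
  intro ω ω' h
  simp only [Set.mem_preimage]
  refine hA _ _ (Set.ext fun v => ?_)
  simp only [Set.mem_inter_iff, Set.mem_compl_iff]
  constructor
  · rintro ⟨hv, hvS⟩
    refine ⟨fun hv' => hv ?_, hvS⟩
    have : v ∈ ω' ∩ S := ⟨hv', hvS⟩
    rw [← h] at this
    exact this.1
  · rintro ⟨hv, hvS⟩
    refine ⟨fun hv' => hv ?_, hvS⟩
    have : v ∈ ω ∩ S := ⟨hv', hvS⟩
    rw [h] at this
    exact this.1

/-- **A closed separating circuit confines the open cluster of the origin**: if the closed sites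
contain a circuit separating `‖·‖ ≤ R₁` from `‖·‖ ≥ R₂` (`ωᶜ ∈ triOpenCircuit R₁ R₂`, `0 ≤ R₁`),
then every site of the open cluster of `0` has norm `< R₂` (an open path from `0` to `‖y‖ ≥ R₂`
would meet the circuit in a closed site). (Nolin 2008, §2.2: "a white circuit surrounding `0`";
proof of Lemma 42, lower bound: "`P_p(∃` white circuit in `S_{L,2L})`".) [cite: Nolin2008, §7.5, proof of Lemma 42, lower bound (arXiv 0711.4948 numbering); §2.2] -/
theorem siteCluster_subset_of_compl_mem_triOpenCircuit {R₁ R₂ : ℝ} (hR₁ : 0 ≤ R₁)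
    {ω : SiteConfig (Site 2)} (h : ωᶜ ∈ triOpenCircuit R₁ R₂) :
    siteCluster triGraph ω 0 ⊆ {y | ‖triEmbed y‖ < R₂} := by
  intro y hy
  by_contra hyR
  simp only [Set.mem_setOf_eq, not_lt] at hyR
  obtain ⟨_, w, hw, hsep⟩ := h
  obtain ⟨q, hq⟩ := (PathIn.of_mem_siteCluster hy).exists_walk
  obtain ⟨z, hzq, hzw⟩ := hsep 0 y q (by simpa using hR₁) hyR
  exact (hw z hzw).1 (hq z hzq)

/-- Hence the open cluster of the origin is finite. [cite: Nolin2008, §2.2 (a white circuit surrounding 0)] -/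
theorem siteCluster_finite_of_compl_mem_triOpenCircuit {R₁ R₂ : ℝ} (hR₁ : 0 ≤ R₁)
    {ω : SiteConfig (Site 2)} (h : ωᶜ ∈ triOpenCircuit R₁ R₂) :
    (siteCluster triGraph ω 0).Finite :=
  (Finset.finite_toSet _).subset ((siteCluster_subset_of_compl_mem_triOpenCircuit hR₁ h).trans
    (subset_box_of_norm_le (T := R₂) fun _ hv => le_of_lt hv))

/-! ### Gluing the two arms through the open circuit, inside `Λ_{10k}` -/

/-- `|z|_𝕋 ≤ (2/√3) ‖z‖`, in the form: `‖z‖ < 8k + 1` and `2 ≤ k` imply `|z|_𝕋 ≤ 10k`. [folklore] -/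
theorem triNorm_le_ten_mul_of_norm_lt {k : ℕ} (hk : 2 ≤ k) {z : Site 2}
    (hz : ‖triEmbed z‖ < 8 * k + 1) : triNorm z ≤ 10 * k := by
  have hsqrt : (1732 / 1000 : ℝ) < Real.sqrt 3 := by
    rw [Real.lt_sqrt (by norm_num)]; norm_num
  have h1 := mul_triNorm_le_norm_triEmbed z
  have hk2 : (2 : ℝ) ≤ k := by exact_mod_cast hk
  have h0 : (0 : ℝ) ≤ triNorm z := by exact_mod_cast triNorm_nonneg z
  have : (triNorm z : ℝ) < 10 * k + 1 := by nlinarith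
  have : triNorm z < 10 * k + 1 := by exact_mod_cast this
  omega

/-- **The inclusion behind the lower bound** (Nolin 2008, proof of Lemma 41, item 2, lower bound:
"if `0` is connected to `∂S_n` and if there exists a black circuit in `S_{2n/3,n}`, then any
`x ∈ S_{n/3,2n/3}` connected to `∂S_{2n}(x)` will be connected to `0` in `S_n`"), in hexagons and
Euclidean annuli: if `|x|_𝕋 ≤ 4k` (`k ≥ 2`), the origin has an arm to `∂Λ_{10k}`, the open sites
contain a circuit separating `‖·‖ ≤ 4k` from `‖·‖ ≥ 8k`, and `x` has an arm to `x + ∂Λ_{14k}`, then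
`0 ↔ x` inside `Λ_{10k}`: both arms reach norm `≥ 8k` (`‖∂Λ_{10k}‖ ≥ (√3/2)·10k`,
`‖x + ∂Λ_{14k}‖ ≥ (√3/2)·14k - 4k`), so both meet the circuit (`triOpenCircuit_glue`), and the arm
from `x`, cut at its first exit from `‖·‖ < 8k`, as well as the circuit, stay inside `Λ_{10k}`. [cite: Nolin2008, §7.5, proof of Lemma 41, item 2 (lower bound) (arXiv 0711.4948 numbering)] -/
theorem mem_siteConnIn_of_arms_of_circuit {k : ℕ} (hk : 2 ≤ k) {x : Site 2}
    (hx : triNorm x ≤ 4 * k) {ω : SiteConfig (Site 2)} (h0 : ω ∈ triOneArm (10 * k))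
    (hO : ω ∈ triOpenCircuit (4 * k) (2 * (4 * k)))
    (hx' : ω ∈ SiteConfig.relabel (Equiv.subRight x) ⁻¹' triOneArm (14 * k)) :
    ω ∈ siteConnIn triGraph ↑(triBall (10 * k)) 0 x := by
  have hsqrt : (1732 / 1000 : ℝ) < Real.sqrt 3 := by
    rw [Real.lt_sqrt (by norm_num)]; norm_num
  have hk2 : (2 : ℝ) ≤ k := by exact_mod_cast hk
  have hxR : ‖triEmbed x‖ ≤ 4 * k := by
    have h1 := norm_triEmbed_le_triNorm x
    have h2 : (triNorm x : ℝ) ≤ 4 * k := by exact_mod_cast hx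
    linarith
  set ω' : Set (Site 2) := (↑(triBall (10 * k)) : Set (Site 2)) ∩ ω with hω'
  -- (a) the circuit, seen in `ω'`
  have hA' : ω' ∈ triOpenCircuit (4 * k) (2 * (4 * k)) := by
    obtain ⟨v, w, hw, hsep⟩ := hO
    refine ⟨v, w, fun z hz => ⟨⟨?_, (hw z hz).1⟩, (hw z hz).2⟩, hsep⟩
    have hz8 : ‖triEmbed z‖ < 8 * k + 1 := by linarith [(hw z hz).2.2]
    exact Finset.mem_coe.2 (mem_triBall_iff.2 (triNorm_le_ten_mul_of_norm_lt hk hz8))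
  -- (b) the arm from the origin
  obtain ⟨y, hy, hconn⟩ := h0
  have hp : PathIn triGraph ω' 0 y := PathIn.of_mem_siteConnIn hconn
  have hyR : 2 * (4 * (k : ℝ)) ≤ ‖triEmbed y‖ := by
    have h1 := mul_triNorm_le_norm_triEmbed y
    rw [mem_triSphere_iff] at hy
    rw [hy] at h1
    push_cast at h1
    nlinarith
  -- (c) the arm from `x`, cut at its first exit from the disc `‖·‖ < 8k`
  have hx'' : (Equiv.subRight x) '' ω ∈ triOneArm (14 * k) := hx'
  obtain ⟨y'', hy'', hconn''⟩ := hx''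
  have hpath'' : PathIn triGraph ((Equiv.subRight x) '' ω) 0 y'' :=
    (PathIn.of_mem_siteConnIn hconn'').mono Set.inter_subset_right
  have hshift := pathIn_shift (A := (Equiv.subRight x) '' ω) (B := ω) x
    (fun z hz => by
      obtain ⟨w, hw, rfl⟩ := hz
      simpa using hw) hpath''
  rw [zero_add] at hshift
  have hyx : 2 * (4 * (k : ℝ)) ≤ ‖triEmbed (y'' + x)‖ := by
    have h1 := mul_triNorm_le_norm_triEmbed y''
    rw [mem_triSphere_iff] at hy''
    rw [hy''] at h1
    push_cast at h1
    have h2 : ‖triEmbed y''‖ ≤ ‖triEmbed (y'' + x)‖ + ‖triEmbed x‖ := by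
      rw [triEmbed_add]
      exact norm_le_add_norm_add _ _
    nlinarith
  obtain ⟨a, b, ha, hb, hbω, hab, hpa⟩ := hshift.exit (R := {v | ‖triEmbed v‖ < 2 * (4 * (k : ℝ))})
    (show x ∈ {v : Site 2 | ‖triEmbed v‖ < 2 * (4 * (k : ℝ))} by
      simp only [Set.mem_setOf_eq]; linarith)
    (show y'' + x ∉ {v : Site 2 | ‖triEmbed v‖ < 2 * (4 * (k : ℝ))} by
      simp only [Set.mem_setOf_eq, not_lt]; exact hyx)
  simp only [Set.mem_setOf_eq, not_lt] at ha hb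
  have hbR : ‖triEmbed b‖ < 8 * k + 1 := by
    have := norm_triEmbed_le_of_adj hab; linarith
  have hp' : PathIn triGraph ω' x b := by
    refine (hpa.mono ?_).tail hab ⟨?_, hbω⟩
    · rintro v ⟨hv, hvω⟩
      simp only [Set.mem_setOf_eq] at hv
      exact ⟨Finset.mem_coe.2 (mem_triBall_iff.2 (triNorm_le_ten_mul_of_norm_lt hk (by linarith))), hvω⟩
    · exact Finset.mem_coe.2 (mem_triBall_iff.2 (triNorm_le_ten_mul_of_norm_lt hk hbR))
  -- (d) glue: `0 → (circuit) → b`, then back along the arm of `x`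
  have hglue : PathIn triGraph ω' 0 b :=
    triOpenCircuit_glue hA' (by simp) hyR hp hxR hb hp'
  exact (hglue.trans hp'.symm).mem_siteConnIn

/-! ### The lower bound -/

/-- `|x_i| ≤ |x|_𝕋` for both coordinates (a copy of `abs_apply_le_triNorm` of
`MeanClusterSizeUpperBound.lean`, which is not imported here). [folklore] -/
private theorem abs_apply_le_triNorm' (x : Site 2) (i : Fin 2) : |x i| ≤ triNorm x := by
  fin_cases i
  · exact le_max_left _ _
  · exact (le_max_left _ _).trans (le_max_right _ _)

/-- `|x|_𝕋 ≤ |x₀| + |x₁|`; in particular sites of the rhombus `S_{2k}` have `|x|_𝕋 ≤ 4k`. [folklore] -/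
private theorem triNorm_le_four_mul_of_mem_box {k : ℕ} {x : Site 2} (hx : x ∈ box 2 (2 * k)) :
    triNorm x ≤ 4 * k := by
  rw [mem_box] at hx
  have h0 := hx 0
  have h1 := hx 1
  simp only [triNorm, max_le_iff]
  refine ⟨?_, ?_, ?_⟩
  · rw [abs_le]; omega
  · rw [abs_le]; omega
  · rw [abs_le]; omega

/-- **The lower bound** (Nolin 2008, §7.5, Lemma 42 lower bound with Lemma 41 item 2 lower bound, at
`t = 0`: `χ(p) ≥ P_p(∃ white circuit) Σ_{x ∈ S_L} P_p(0 ↔^{S_L} x) ≥ C L² π₁²(L)`). From the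
near-critical stability of ONE arm below `L_ε(p)` alone (the body of `Nolin2008_thm27_oneArm` at
`ε`; only its lower half `P_p(0 ↔ ∂Λ_N) ≥ c₁ π₁(N)`, `N ≤ L_ε(p)`, is used), for `ε ∈ (0, 1/2)`:
there are `δ > 0`, `L₀`, `c > 0` with `χ^f(p) ≥ c L_ε(p)² π₁(L_ε(p))²` for all `p ≠ 1/2` with
`|p - 1/2| < δ` and `L_ε(p) ≥ L₀`. Proof, with `k = 4⌊L/64⌋ + 2 ≡ 2 (mod 4)` (`k ≍ L/16`),
`k' = 2k + 2`: for each of the `(4k+1)²` sites `x` of `S_{2k}`,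
`P_p(0 ↔ x, |C(0)| < ∞) ≥ P_p(0 ↔ x in Λ_{10k}) · P_p(closed circuit in 5k' ≤ |·|_𝕋 ≤ 7k')`
(disjoint supports; a closed circuit around `Λ_{10k}` makes `C(0)` finite), where the second factor
is `P_{1-p}` of six long open crossings `≥ P_{1-p}(LR(7k', k'))⁶ ≥ c₇⁶` (RSW below `L_ε` for the
sub-critical colour, `exists_le_triLRCrossingProb_seven_below_charLength`), and the first is at least
`P_p(0 ↔ ∂Λ_{10k}) · P_p(open circuit in (4k, 8k)) · P_p(x ↔ x + ∂Λ_{14k}) ≥ c₁ π₁(L) · c₇⁶ · c₁ π₁(L)`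
(Harris; `mem_siteConnIn_of_arms_of_circuit`; one-arm stability at the scales `10k, 14k ≤ L` and
`π₁(10k), π₁(14k) ≥ π₁(L)`). Both colours are handled at once: the RSW input holds for every
`q ≥ min(p, 1-p)`. [cite: Nolin2008, §7.5, Lemma 42 (lower bound) and proof of Lemma 41, item 2 (arXiv 0711.4948 numbering)] -/
theorem triMeanClusterSize_ge_sq_at {ε : ℝ} (hε : 0 < ε)
    (h27 : ∃ δ > (0 : ℝ), ∃ c > (0 : ℝ), ∃ C : ℝ,
      ∀ p : unitInterval, (p : ℝ) ≠ 1 / 2 → |(p : ℝ) - 1 / 2| < δ →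
        ∀ N ≤ charLength ε p,
          c * critOneArmProb N ≤ (triSitePercolation p).real (triOneArm N) ∧
            (triSitePercolation p).real (triOneArm N) ≤ C * critOneArmProb N) :
    ∃ δ > (0 : ℝ), ∃ L₀ : ℕ, ∃ c > (0 : ℝ), ∀ p : unitInterval, (p : ℝ) ≠ 1 / 2 →
      |(p : ℝ) - 1 / 2| < δ → L₀ ≤ charLength ε p →
        ENNReal.ofReal (c * ((charLength ε p : ℝ) ^ 2 * critOneArmProb (charLength ε p) ^ 2)) ≤
          triMeanClusterSize p := by
  classical
  obtain ⟨δ, hδ, c₁, hc₁, C₁, h27'⟩ := h27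
  obtain ⟨c₇, hc₇, hRSW⟩ := exists_le_triLRCrossingProb_seven_below_charLength hε
  refine ⟨δ, hδ, 400, c₁ ^ 2 * c₇ ^ 12 / 64, by positivity, fun p hp hpδ hL₀ => ?_⟩
  -- scales
  obtain ⟨L, hLdef⟩ : ∃ L : ℕ, L = charLength ε p := ⟨_, rfl⟩
  rw [← hLdef] at hL₀ ⊢
  obtain ⟨k, hk⟩ : ∃ k : ℕ, k = 4 * (L / 64) + 2 := ⟨_, rfl⟩
  have hk6 : 6 ≤ k := by omega
  have hk2 : 2 ≤ k := by omega
  have hk4 : k % 4 = 2 := by omega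
  have h14k : 14 * k ≤ L := by omega
  have h10k : 10 * k ≤ L := by omega
  have hkL : k < L := by omega
  have hk'6 : 6 ≤ 2 * k + 2 := by omega
  have hk'4 : (2 * k + 2) % 4 = 2 := by omega
  have hk'L : 2 * k + 2 < L := by omega
  have h4k : L ≤ 8 * (4 * k + 1) := by omega
  have hLk : ∀ N ≤ L, c₁ * critOneArmProb N ≤ (triSitePercolation p).real (triOneArm N) :=
    fun N hN => (h27' p hp hpδ N (by rw [← hLdef]; exact hN)).1
  -- RSW inputs at `q = p` (scale `k`) and `q = 1 - p` (scale `k' = 2k + 2`)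
  have hmin := min_le_left (p : unitInterval) (σ p)
  have hmin' := min_le_right (p : unitInterval) (σ p)
  have hO6 : c₇ ^ 6 ≤ (triSitePercolation p).real (triOpenCircuit (4 * k) (2 * (4 * k))) := by
    have h1 : c₇ ≤ triLRCrossingProb p (7 * k) k := hRSW p p hmin k hk6 hk4 (by rw [← hLdef]; exact hkL)
    calc c₇ ^ 6 ≤ triLRCrossingProb p (7 * k) k ^ 6 := pow_le_pow_left₀ hc₇.le h1 6
      _ ≤ (triSitePercolation p).real (⋂ j < 6, isoTBCrossing (pieceIso k j) k (7 * k)) :=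
          pow_six_le_real_iInter_isoTBCrossing_at p k
      _ ≤ (triSitePercolation p).real (triOpenCircuit (4 * k) (2 * (4 * k))) :=
          measureReal_mono fun ω hω => mem_triOpenCircuit_of_pieces (by omega) hω
  set Wev : Set (SiteConfig (Site 2)) :=
    ⋂ j < 6, isoTBCrossing (pieceIso (2 * k + 2) j) (2 * k + 2) (7 * (2 * k + 2)) with hWev
  have hW6 : c₇ ^ 6 ≤ (triSitePercolation p).real (compl ⁻¹' Wev) := by
    have h1 : c₇ ≤ triLRCrossingProb (σ p) (7 * (2 * k + 2)) (2 * k + 2) :=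
      hRSW p (σ p) hmin' (2 * k + 2) hk'6 hk'4 (by rw [← hLdef]; exact hk'L)
    have h2 : (triSitePercolation p).real (compl ⁻¹' Wev) = (triSitePercolation (σ p)).real Wev :=
      sitePercolation_real_preimage_compl p Wev
    rw [h2]
    calc c₇ ^ 6 ≤ triLRCrossingProb (σ p) (7 * (2 * k + 2)) (2 * k + 2) ^ 6 :=
          pow_le_pow_left₀ hc₇.le h1 6
      _ ≤ (triSitePercolation (σ p)).real Wev := pow_six_le_real_iInter_isoTBCrossing_at (σ p) _
  -- one-arm inputs
  have hπL0 : 0 ≤ critOneArmProb L := measureReal_nonneg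
  have hπ10 : critOneArmProb L ≤ critOneArmProb (10 * k) :=
    measureReal_mono (triOneArm_anti (by omega) h10k)
  have hπ14 : critOneArmProb L ≤ critOneArmProb (14 * k) :=
    measureReal_mono (triOneArm_anti (by omega) h14k)
  have hD : c₁ * critOneArmProb L ≤ (triSitePercolation p).real (triOneArm (10 * k)) :=
    (mul_le_mul_of_nonneg_left hπ10 hc₁.le).trans (hLk _ h10k)
  -- the per-site bound
  have hsite : ∀ x ∈ box 2 (2 * k), c₁ ^ 2 * c₇ ^ 12 * critOneArmProb L ^ 2 ≤
      (triSitePercolation p).real (triFinConn 0 x) := by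
    intro x hxbox
    have hx : triNorm x ≤ 4 * k := triNorm_le_four_mul_of_mem_box hxbox
    -- the three increasing events and their common window `S_{30k}`
    set D : Set (SiteConfig (Site 2)) := triOneArm (10 * k) with hDdef
    set Y0 : Set (SiteConfig (Site 2)) := triOpenCircuit (4 * k) (2 * (4 * k)) with hY0
    set Y1 : Set (SiteConfig (Site 2)) := SiteConfig.relabel (Equiv.subRight x) ⁻¹' triOneArm (14 * k)
      with hY1
    have hDdet : DeterminedBy D ↑(box 2 (30 * k)) := by
      refine (determinedBy_triOneArm (10 * k)).mono fun z hz => ?_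
      have hz' := mem_triBall_iff.1 (Finset.mem_coe.1 hz)
      rw [Finset.mem_coe, mem_box]
      intro i
      have := abs_apply_le_triNorm' z i
      rw [abs_le] at this
      push_cast
      omega
    have hY0det : DeterminedBy Y0 ↑(box 2 (30 * k)) := by
      refine (determinedBy_triOpenCircuit _ _).mono fun z hz => ?_
      have hz2 : ‖triEmbed z‖ ≤ 2 * (4 * (k : ℝ)) := le_of_lt hz.2
      have hmem := mem_box_of_norm_triEmbed_le hz2
      have hceil : ⌈2 * (2 * (4 * (k : ℝ)))⌉₊ = 16 * k := by
        rw [show (2 * (2 * (4 * (k : ℝ)))) = ((16 * k : ℕ) : ℝ) by push_cast; ring, Nat.ceil_natCast]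
      rw [hceil] at hmem
      exact Finset.mem_coe.2 (box_mono 2 (by omega) hmem)
    have hY1det : DeterminedBy Y1 ↑(box 2 (30 * k)) := by
      refine (determinedBy_preimage_relabel_triOneArm x (14 * k)).mono fun z hz => ?_
      rw [Finset.coe_image] at hz
      obtain ⟨w, hw, rfl⟩ := hz
      have hw' := mem_triBall_iff.1 (Finset.mem_coe.1 hw)
      rw [Finset.mem_coe, mem_box]
      intro i
      have h1 := abs_apply_le_triNorm' w i
      have h2 := abs_apply_le_triNorm' x i
      rw [abs_le] at h1 h2
      simp only [Pi.add_apply]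
      push_cast
      omega
    have hDu : IsUpperSet D := isUpperSet_triOneArm _
    have hY0u : IsUpperSet Y0 := isUpperSet_triOpenCircuit _ _
    have hY1u : IsUpperSet Y1 := isUpperSet_preimage_relabel _ (isUpperSet_triOneArm _)
    -- Harris, twice
    have hH1 : (triSitePercolation p).real D * (triSitePercolation p).real Y0 ≤
        (triSitePercolation p).real (D ∩ Y0) := sitePercolation_harris' p hDdet hY0det hDu hY0u
    have hH2 : (triSitePercolation p).real (D ∩ Y0) * (triSitePercolation p).real Y1 ≤
        (triSitePercolation p).real (D ∩ Y0 ∩ Y1) :=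
      sitePercolation_harris' p (hDdet.inter hY0det) hY1det (hDu.inter hY0u) hY1u
    -- the three factors
    have hY1eq : (triSitePercolation p).real Y1 = (triSitePercolation p).real (triOneArm (14 * k)) :=
      sitePercolation_real_preimage_relabel (Equiv.subRight x) p (triOneArm (14 * k))
    have hF : c₁ * critOneArmProb L ≤ (triSitePercolation p).real Y1 := by
      rw [hY1eq]; exact (mul_le_mul_of_nonneg_left hπ14 hc₁.le).trans (hLk _ h14k)
    -- `D ∩ Y0 ∩ Y1 ⊆ E_x = {0 ↔ x in Λ_{10k}}`, and `E_x ∩ W ⊆ triFinConn 0 x`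
    set E : Set (SiteConfig (Site 2)) := siteConnIn triGraph ↑(triBall (10 * k)) 0 x with hE
    have hincl : D ∩ Y0 ∩ Y1 ⊆ E := fun ω ⟨⟨hD', hO'⟩, hx'⟩ =>
      mem_siteConnIn_of_arms_of_circuit hk2 hx hD' hO' hx'
    have hEW : E ∩ compl ⁻¹' Wev ⊆ triFinConn 0 x := by
      rintro ω ⟨hωE, hωW⟩
      refine ⟨?_, ?_⟩
      · have : ω ∈ {ω : SiteConfig (Site 2) | x ∈ siteCluster triGraph ω 0} := by
          rw [triConn_eq_iUnion]
          exact Set.mem_iUnion.2 ⟨_, hωE⟩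
        exact this
      · exact siteCluster_finite_of_compl_mem_triOpenCircuit (R₁ := 4 * (2 * k + 2 : ℕ))
          (by positivity) (mem_triOpenCircuit_of_pieces (by omega) hωW)
    -- independence of `E` (inside `Λ_{10k}`) and `W` (on `5k' ≤ |·|_𝕋 ≤ 7k'`, `5k' > 10k`)
    have hEdet : DeterminedBy E ↑(triBall (10 * k)) := determinedBy_siteConnIn _ _ _ _
    have hWdet : DeterminedBy (compl ⁻¹' Wev)
        ↑((box 2 (7 * (2 * k + 2))).filter fun z => (5 * (2 * k + 2) : ℤ) ≤ triNorm z) :=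
      determinedBy_compl_preimage (determinedBy_iInter_isoTBCrossing (2 * k + 2))
    have hdisj : Disjoint (triBall (10 * k))
        ((box 2 (7 * (2 * k + 2))).filter fun z => (5 * (2 * k + 2) : ℤ) ≤ triNorm z) := by
      rw [Finset.disjoint_left]
      intro z hz hz'
      have h1 := mem_triBall_iff.1 hz
      have h2 := (Finset.mem_filter.1 hz').2
      push_cast at h1 h2
      omega
    have hind : (triSitePercolation p).real (E ∩ compl ⁻¹' Wev) =
        (triSitePercolation p).real E * (triSitePercolation p).real (compl ⁻¹' Wev) :=
      sitePercolation_real_inter_of_disjoint p hEdet hWdet hdisj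
    -- assemble
    have hP0 : 0 ≤ (triSitePercolation p).real D := measureReal_nonneg
    have hPY0 : 0 ≤ (triSitePercolation p).real Y0 := measureReal_nonneg
    have hcπ : 0 ≤ c₁ * critOneArmProb L := by positivity
    calc c₁ ^ 2 * c₇ ^ 12 * critOneArmProb L ^ 2
        = ((c₁ * critOneArmProb L) * c₇ ^ 6 * (c₁ * critOneArmProb L)) * c₇ ^ 6 := by ring
      _ ≤ ((triSitePercolation p).real D * (triSitePercolation p).real Y0 *
            (triSitePercolation p).real Y1) * (triSitePercolation p).real (compl ⁻¹' Wev) := by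
          have h1 : (c₁ * critOneArmProb L) * c₇ ^ 6 ≤
              (triSitePercolation p).real D * (triSitePercolation p).real Y0 :=
            mul_le_mul hD hO6 (by positivity) hP0
          have h2 : (c₁ * critOneArmProb L) * c₇ ^ 6 * (c₁ * critOneArmProb L) ≤
              (triSitePercolation p).real D * (triSitePercolation p).real Y0 *
                (triSitePercolation p).real Y1 :=
            mul_le_mul h1 hF hcπ (by positivity)
          exact mul_le_mul h2 hW6 (by positivity) (by positivity)
      _ ≤ (triSitePercolation p).real (D ∩ Y0 ∩ Y1) * (triSitePercolation p).real (compl ⁻¹' Wev) := by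
          refine mul_le_mul_of_nonneg_right ?_ measureReal_nonneg
          exact (mul_le_mul_of_nonneg_right hH1 measureReal_nonneg).trans hH2
      _ ≤ (triSitePercolation p).real E * (triSitePercolation p).real (compl ⁻¹' Wev) :=
          mul_le_mul_of_nonneg_right (measureReal_mono hincl) measureReal_nonneg
      _ = (triSitePercolation p).real (E ∩ compl ⁻¹' Wev) := hind.symm
      _ ≤ (triSitePercolation p).real (triFinConn 0 x) := measureReal_mono hEW
  -- sum over `S_{2k}`: `(4k+1)²` sites, `(4k+1)² ≥ L²/64`
  have hsum : c₁ ^ 2 * c₇ ^ 12 / 64 * ((L : ℝ) ^ 2 * critOneArmProb L ^ 2) ≤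
      ∑ x ∈ box 2 (2 * k), (triSitePercolation p).real (triFinConn 0 x) := by
    have hcard : ((box 2 (2 * k)).card : ℝ) = (4 * (k : ℝ) + 1) ^ 2 := by
      rw [card_box]; push_cast; ring
    have hL4 : (L : ℝ) ≤ 8 * (4 * (k : ℝ) + 1) := by exact_mod_cast h4k
    have hL0 : (0 : ℝ) ≤ L := Nat.cast_nonneg L
    calc c₁ ^ 2 * c₇ ^ 12 / 64 * ((L : ℝ) ^ 2 * critOneArmProb L ^ 2)
        ≤ c₁ ^ 2 * c₇ ^ 12 / 64 * ((8 * (4 * (k : ℝ) + 1)) ^ 2 * critOneArmProb L ^ 2) := by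
          refine mul_le_mul_of_nonneg_left (mul_le_mul_of_nonneg_right ?_ (sq_nonneg _)) (by positivity)
          exact pow_le_pow_left₀ hL0 hL4 2
      _ = ((box 2 (2 * k)).card : ℝ) * (c₁ ^ 2 * c₇ ^ 12 * critOneArmProb L ^ 2) := by
          rw [hcard]; ring
      _ = ∑ x ∈ box 2 (2 * k), c₁ ^ 2 * c₇ ^ 12 * critOneArmProb L ^ 2 := by
          rw [Finset.sum_const, nsmul_eq_mul]
      _ ≤ ∑ x ∈ box 2 (2 * k), (triSitePercolation p).real (triFinConn 0 x) :=
          Finset.sum_le_sum hsite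
  -- conclusion in `ℝ≥0∞`
  rw [triMeanClusterSize_eq_tsum]
  calc ENNReal.ofReal (c₁ ^ 2 * c₇ ^ 12 / 64 * ((L : ℝ) ^ 2 * critOneArmProb L ^ 2))
      ≤ ENNReal.ofReal (∑ x ∈ box 2 (2 * k), (triSitePercolation p).real (triFinConn 0 x)) :=
        ENNReal.ofReal_le_ofReal hsum
    _ = ∑ x ∈ box 2 (2 * k), triSitePercolation p (triFinConn 0 x) := by
        rw [ENNReal.ofReal_sum_of_nonneg (fun x _ => measureReal_nonneg)]
        exact Finset.sum_congr rfl fun x _ => ofReal_measureReal (measure_ne_top _ _)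
    _ ≤ ∑' x, triSitePercolation p (triFinConn 0 x) := ENNReal.sum_le_tsum _

/-- The same from the named fact `Nolin2008_thm27_oneArm`, at a fixed `ε ∈ (0, 1/2)`. [cite: Nolin2008, §7.5, Lemma 42 (lower bound) (arXiv 0711.4948 numbering)] -/
theorem triMeanClusterSize_ge_sq (h27 : Nolin2008_thm27_oneArm) {ε : ℝ} (hε : 0 < ε) (hε' : ε < 1 / 2) :
    ∃ δ > (0 : ℝ), ∃ L₀ : ℕ, ∃ c > (0 : ℝ), ∀ p : unitInterval, (p : ℝ) ≠ 1 / 2 →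
      |(p : ℝ) - 1 / 2| < δ → L₀ ≤ charLength ε p →
        ENNReal.ofReal (c * ((charLength ε p : ℝ) ^ 2 * critOneArmProb (charLength ε p) ^ 2)) ≤
          triMeanClusterSize p :=
  triMeanClusterSize_ge_sq_at hε (h27 hε hε')

/-- **The lower power bound**: from `χ^f ≥ c L_ε² π₁(L_ε)²` (for `L_ε ≥ L₀`) and the one-arm
exponent (`π₁(L) ≥ L^{-5/48 - η/2}` for large `L`), for every `η > 0`:
`χ^f(p) ≥ c L_ε(p)^{43/24 - η}` for `p ≠ 1/2` near `1/2` with `L_ε(p)` large — the shape consumed by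
`triMeanClusterSize_exponent_of_powerBounds`. [cite: Nolin2008, §7.5, Lemma 42 (lower bound) and the display after Prop. 43 (arXiv 0711.4948 numbering)] -/
theorem triMeanClusterSize_powerLowerBound_of_sq_at {ε : ℝ} (h₁ : oneArm_exponent)
    (hlow : ∃ δ > (0 : ℝ), ∃ L₀ : ℕ, ∃ c > (0 : ℝ), ∀ p : unitInterval, (p : ℝ) ≠ 1 / 2 →
      |(p : ℝ) - 1 / 2| < δ → L₀ ≤ charLength ε p →
        ENNReal.ofReal (c * ((charLength ε p : ℝ) ^ 2 * critOneArmProb (charLength ε p) ^ 2)) ≤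
          triMeanClusterSize p) :
    ∀ η : ℝ, 0 < η → ∃ δ > (0 : ℝ), ∃ L₀ : ℕ, ∃ c > (0 : ℝ), ∀ p : unitInterval,
      (p : ℝ) ≠ 1 / 2 → |(p : ℝ) - 1 / 2| < δ → L₀ ≤ charLength ε p →
        ENNReal.ofReal (c * (charLength ε p : ℝ) ^ ((43 : ℝ) / 24 - η)) ≤ triMeanClusterSize p := by
  intro η hη
  obtain ⟨δ, hδ, L₀, c, hc, h⟩ := hlow
  have hπ : HasDecayExponent critOneArmProb (5 / 48) := h₁
  have hev : ∀ᶠ m : ℕ in atTop, -(5 / 48) - η / 2 < Real.log (critOneArmProb m) / Real.log m :=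
    hπ.eventually (lt_mem_nhds (by linarith))
  have hpos : ∀ᶠ m : ℕ in atTop, 0 < critOneArmProb m :=
    hasDecayExponent_eventually_pos hπ (by norm_num) (fun _ => measureReal_nonneg)
  obtain ⟨M₀, hM₀⟩ := eventually_atTop.1 (hev.and (hpos.and (eventually_ge_atTop 2)))
  refine ⟨δ, hδ, max L₀ M₀, c, hc, fun p hp hpδ hL => ?_⟩
  obtain ⟨hlt, hπpos, hm2⟩ := hM₀ _ ((le_max_right _ _).trans hL)
  set L := charLength ε p with hLdef
  have hL1 : (1 : ℝ) < L := by exact_mod_cast (show 1 < L by omega)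
  have hL0 : (0 : ℝ) < L := by linarith
  have hlogL : 0 < Real.log L := Real.log_pos hL1
  have hπL : (L : ℝ) ^ (-(5 / 48 : ℝ) - η / 2) ≤ critOneArmProb L := by
    rw [lt_div_iff₀ hlogL] at hlt
    rw [Real.rpow_def_of_pos hL0, ← Real.exp_log hπpos]
    exact Real.exp_le_exp.2 (by linarith [mul_comm (Real.log L) (-(5 / 48 : ℝ) - η / 2)])
  refine le_trans (ENNReal.ofReal_le_ofReal ?_) (h p hp hpδ ((le_max_left _ _).trans hL))
  refine mul_le_mul_of_nonneg_left ?_ hc.le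
  have hsq : ((L : ℝ) ^ (-(5 / 48 : ℝ) - η / 2)) ^ 2 ≤ critOneArmProb L ^ 2 :=
    pow_le_pow_left₀ (Real.rpow_nonneg hL0.le _) hπL 2
  calc (L : ℝ) ^ ((43 : ℝ) / 24 - η) = (L : ℝ) ^ 2 * ((L : ℝ) ^ (-(5 / 48 : ℝ) - η / 2)) ^ 2 := by
        rw [sq ((L : ℝ) ^ _), ← Real.rpow_add hL0, ← Real.rpow_two, ← Real.rpow_add hL0]
        congr 1; ring
    _ ≤ (L : ℝ) ^ 2 * critOneArmProb L ^ 2 := mul_le_mul_of_nonneg_left hsq (by positivity)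

end Literature.Probability.Percolation
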